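import Summits.CriticalPhenomena.PercolationContinuityZ3.Theorems.PercNearOneGluingNoHeavyPcintTFibCountDom
import Summits.CriticalPhenomena.PercolationContinuityZ3.Theorems.PercNearOneGluingNoHeavyPcintTFibProcess
import Summits.CriticalPhenomena.PercolationContinuityZ3.Theorems.PercNearOneGluingNoHeavyPcintProductResampling
import HarnessLib

/-!
# PCINT lane, T-fibre route, step (3b): the one-step law of the fibre process and its dominance from tail tables

Cell `prim-pcint`, seat `prim-pcint-1` (gen 11); memo `run/shared/lean/prim/pcint/T-FIBRE-ROUTE.md` §3–4.
Finite-sum lemmas, no new facts, no `sorry`.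

After the fibre factorisation (step (3a)), one step of the fibre process with selected parent `c` examined by `d`
reads: the fibre state `x = u c` is distributed by `π_p^{ZMod m}` CONDITIONED on meeting `H = w d` (the open layers of
the examiner), and the children `a ∈ C` report `meet x (u a)` for fresh fibre states `u a`, i.e. i.i.d. bits with
success probability `ρ(x) = 1 - (1-p)^{#x}` (`sum_wt_filter_meet`).  This file proves:

* `AdaptDom.sum_pw_pat_eq_sum_wt` — **patterns of i.i.d. sites are `π_r`-distributed**: if every read `ψ v (u v)`,
  `v ∈ T`, has probability exactly `r`, then `E[g(pattern)] = E_{π_r}[g]` for step tests `g` of `T` (equality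
  version of `AdaptDom.sum_wt_le_sum_pw_pat`);
* `TFib.sum_wt_meet_mul_eq` — **regrouping by the number of open layers**:
  `Σ_x π_p(x) [meet H x] φ(#x) = Σ_u (C(m,u) - C(m-h,u)) p^u (1-p)^{m-u} φ(u)`, `h = #H`;
* `TFib.typeIneq_of_table` — **the per-type dominance** `(Σ_x π_p(x)[meet H x]) · E_{π_s}[g] ≤
  Σ_x π_p(x)[meet H x] · E_{π_{ρ(x)}}[g]` for every `H` and every step test `g` of a set of `k` children, from the
  `k` closed-form tail inequalities of the table (`AdaptDom.mixture_dominates_of_tails`).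
-/

namespace Summit.CriticalPhenomena.PercolationContinuityZ3.Theorems.Pcint

open Finset

/-! ### Patterns of i.i.d. reads are product-distributed -/

namespace AdaptDom

variable {V : Type*} [Fintype V] [DecidableEq V] {S : Type*} [Fintype S] [DecidableEq S]

omit [DecidableEq S] in
/-- **Patterns of i.i.d. sites are `π_r`-distributed**: if the read `ψ v (u v)` of every site `v ∈ T` of a
`pw m`-distributed `u` is `true` with probability exactly `r`, then `E[g(pattern)] = E_{π_r}[g]` for every step test
function `g` of `T`. -/
theorem sum_pw_pat_eq_sum_wt (m : S → ℝ) (hm1 : ∑ s, m s = 1) (r : ℝ) (ψ : V → S → Bool) (T : Finset V)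
    (hr : ∀ v ∈ T, ∑ s ∈ univ.filter (fun s => ψ v s = true), m s = r) (g : (V → Bool) → ℝ) (hg : StepTest T g) :
    ∑ u : V → S, pw (fun _ => m) u * g (fun v => if v ∈ T then ψ v (u v) else false) = ∑ ω : V → Bool, wt r ω * g ω := by
  induction T using Finset.induction_on generalizing g with
  | empty =>
    have hc : ∀ x : V → Bool, g x = g (fun _ => false) := fun x => hg.2 _ _ fun v hv => absurd hv (by simp)
    have h1 : ∑ u : V → S, pw (fun _ => m) u * g (fun _ => false) = g (fun _ => false) := by
      rw [← Finset.sum_mul, sum_pw (fun _ => hm1), one_mul]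
    have h2 : ∑ ω : V → Bool, wt r ω * g ω = g (fun _ => false) := by
      rw [Finset.sum_congr rfl fun ω _ => by rw [hc ω], ← Finset.sum_mul, sum_wt, one_mul]
    simp only [Finset.notMem_empty, if_false]
    rw [h1, h2]
  | insert a T haT ih =>
    have hpat : ∀ (u : V → S) (s : S), (fun v => if v ∈ insert a T then ψ v (Function.update u a s v) else false) =
        Function.update (fun v => if v ∈ T then ψ v (u v) else false) a (ψ a s) := by
      intro u s; funext v
      by_cases hva : v = a
      · subst hva; simp
      · rw [Function.update_of_ne hva, Function.update_of_ne hva]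
        simp [Finset.mem_insert, hva]
    have hgb : ∀ b : Bool, StepTest T (fun x => g (Function.update x a b)) := by
      intro b
      refine ⟨fun x x' h => hg.1 _ _ fun v hv => ?_, fun x x' h => hg.2 _ _ fun v hv => ?_⟩ <;>
      · by_cases hva : v = a
        · subst hva; simp
        · rw [Function.update_of_ne hva, Function.update_of_ne hva]
          rcases Finset.mem_insert.1 hv with h' | h'
          · exact absurd h' hva
          · exact h v h'
    rw [sum_pw_resample (fun _ => m) (fun _ => hm1) a]
    simp_rw [hpat]
    have hmq1 : ∀ v : V, ∑ b, (fun (_ : V) (b : Bool) => bern r b) v b = 1 := fun _ => sum_bern r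
    -- the one-site law of the read at `a` is `bern r`
    have hra := hr a (Finset.mem_insert_self a T)
    have hlawT : lawB (fun (_ : V) => m) ψ (some a) true = bern r true := by
      simp only [lawB, bern, if_true]; exact hra
    have hlawF : lawB (fun (_ : V) => m) ψ (some a) false = bern r false := by
      have h := sum_lawB (fun (_ : V) => m) (fun _ => hm1) ψ (some a)
      rw [Fintype.sum_bool, hlawT] at h
      simp only [bern, if_true, Bool.false_eq_true, if_false] at h ⊢
      linarith
    have step : ∀ u : V → S, ∑ s, m s * g (Function.update (fun v => if v ∈ T then ψ v (u v) else false) a (ψ a s)) =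
        ∑ b, bern r b * g (Function.update (fun v => if v ∈ T then ψ v (u v) else false) a b) := by
      intro u
      set x := (fun v => if v ∈ T then ψ v (u v) else false) with hx
      have hgroup : ∑ s, m s * g (Function.update x a (ψ a s)) =
          ∑ b, lawB (fun (_ : V) => m) ψ (some a) b * g (Function.update x a b) := by
        rw [Fintype.sum_bool]
        simp only [lawB, Finset.sum_mul]
        rw [← Finset.sum_filter_add_sum_filter_not univ (fun s => ψ a s = true)]
        congr 1
        · exact Finset.sum_congr rfl fun s hs => by rw [(Finset.mem_filter.1 hs).2]
        · refine Finset.sum_congr (by ext s; simp) fun s hs => ?_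
          have : ψ a s = false := by simpa using (Finset.mem_filter.1 hs).2
          rw [this]
      rw [hgroup, Fintype.sum_bool, Fintype.sum_bool, hlawT, hlawF]
    calc ∑ u : V → S, pw (fun _ => m) u *
            ∑ s, m s * g (Function.update (fun v => if v ∈ T then ψ v (u v) else false) a (ψ a s))
        = ∑ u : V → S, pw (fun _ => m) u *
            ∑ b, bern r b * g (Function.update (fun v => if v ∈ T then ψ v (u v) else false) a b) :=
          Finset.sum_congr rfl fun u _ => by rw [step u]
      _ = ∑ b, bern r b * ∑ u : V → S, pw (fun _ => m) u *
            g (Function.update (fun v => if v ∈ T then ψ v (u v) else false) a b) := by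
          simp_rw [Finset.mul_sum]; rw [Finset.sum_comm]
          exact Finset.sum_congr rfl fun u _ => Finset.sum_congr rfl fun b _ => by ring
      _ = ∑ b, bern r b * ∑ ω : V → Bool, wt r ω * g (Function.update ω a b) :=
          Finset.sum_congr rfl fun b _ => by
            rw [ih (fun v hv => hr v (Finset.mem_insert_of_mem hv)) (fun x => g (Function.update x a b)) (hgb b)]
      _ = ∑ ω : V → Bool, wt r ω * ∑ b, bern r b * g (Function.update ω a b) := by
          simp_rw [Finset.mul_sum]; rw [Finset.sum_comm]
          exact Finset.sum_congr rfl fun b _ => Finset.sum_congr rfl fun ω _ => by simp only [wt]; ring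
      _ = ∑ ω : V → Bool, wt r ω * g ω := (sum_pw_resample (fun (_ : V) (b : Bool) => bern r b) hmq1 a g).symm

/-- A product-weight sum as a sum over the sets of `true` coordinates. -/
theorem sum_wt_eq_sum_finset (r : ℝ) (F : (V → Bool) → ℝ) :
    ∑ ω : V → Bool, wt r ω * F ω = ∑ A : Finset V, r ^ A.card * (1 - r) ^ (Fintype.card V - A.card) * F (indB A) := by
  classical
  refine Fintype.sum_equiv trueSetEquiv _ _ fun ω => ?_
  rw [wt_eq_pow]
  have hω : indB (trueSet ω) = ω := trueSetEquiv.left_inv ω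
  change _ = r ^ (trueSet ω).card * (1 - r) ^ (Fintype.card V - (trueSet ω).card) * F (indB (trueSet ω))
  rw [hω]

end AdaptDom

/-! ### The one-step law of the fibre process -/

namespace TFib

open AdaptDom

variable {m : ℕ} [NeZero m]

/-- `meet x y` in terms of the sets of open layers. -/
theorem meet_eq_true_iff_not_disjoint (x y : ZMod m → Bool) :
    meet m x y = true ↔ ¬ Disjoint (trueSet x) (trueSet y) := by
  rw [meet_eq_true_iff, Finset.not_disjoint_iff]
  simp only [mem_trueSet]

/-- `meet x (𝟙_A) = false ↔ A ⊆ (open layers of x)ᶜ`. -/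
theorem meet_indB_eq_false_iff (x : ZMod m → Bool) (A : Finset (ZMod m)) :
    meet m x (indB A) = false ↔ A ∈ (trueSet x)ᶜ.powerset := by
  rw [mem_powerset, ← Bool.not_eq_true, meet_eq_true_iff_not_disjoint, not_not]
  have : trueSet (indB A) = A := trueSetEquiv.right_inv A
  rw [this, Finset.disjoint_right]
  constructor
  · intro h a ha; exact mem_compl.2 (h ha)
  · intro h a ha; exact mem_compl.1 (h ha)

/-- Sums over a powerset of a summand depending only on the cardinality, grouped by cardinality. -/
theorem sum_powerset_card_eq {α : Type*} [DecidableEq α] (X : Finset α) (t : ℕ → ℝ) :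
    ∑ A ∈ X.powerset, t A.card = ∑ u ∈ range (X.card + 1), (X.card.choose u : ℝ) * t u := by
  rw [powerset_card_disjiUnion, sum_disjiUnion]
  refine Finset.sum_congr rfl fun u _ => ?_
  rw [Finset.sum_congr rfl fun A hA => by rw [(mem_powersetCard.1 hA).2], sum_const, card_powersetCard, nsmul_eq_mul]

/-- `ZMod m` has `m` elements (as `Fintype.card`). -/
theorem card_zmod : Fintype.card (ZMod m) = m := ZMod.card m

/-- **The law of one read**: the `π_p`-probability that a fresh fibre state meets `x` is `1 - (1-p)^{#x}`. -/
theorem sum_wt_filter_meet (p : ℝ) (x : ZMod m → Bool) :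
    ∑ y ∈ univ.filter (fun y => meet m x y = true), wt p y = 1 - (1 - p) ^ (trueSet x).card := by
  classical
  have htot := sum_wt (V := ZMod m) p
  rw [← Finset.sum_filter_add_sum_filter_not univ (fun y => meet m x y = true)] at htot
  -- the complementary sum
  have hno : ∑ y ∈ univ.filter (fun y => ¬ meet m x y = true), wt p y = (1 - p) ^ (trueSet x).card := by
    have e1 : ∑ y ∈ univ.filter (fun y => ¬ meet m x y = true), wt p y =
        ∑ y : ZMod m → Bool, wt p y * (if meet m x y = false then 1 else 0) := by
      rw [Finset.sum_filter]
      refine Finset.sum_congr rfl fun y _ => ?_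
      by_cases h : meet m x y = true
      · rw [if_neg (not_not.2 h), if_neg (by rw [h]; decide), mul_zero]
      · rw [if_pos h, if_pos (Bool.eq_false_iff.2 h), mul_one]
    rw [e1, sum_wt_eq_sum_finset]
    have e2 : ∑ A : Finset (ZMod m), p ^ A.card * (1 - p) ^ (Fintype.card (ZMod m) - A.card) *
        (if meet m x (indB A) = false then (1 : ℝ) else 0) =
        ∑ A ∈ (trueSet x)ᶜ.powerset, p ^ A.card * (1 - p) ^ (Fintype.card (ZMod m) - A.card) := by
      rw [← Finset.sum_filter_of_ne (s := univ) (p := fun A => A ∈ (trueSet x)ᶜ.powerset)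
        (fun A _ hA => by
          by_contra hA'
          rw [← meet_indB_eq_false_iff] at hA'
          exact hA (by rw [if_neg hA', mul_zero]))]
      refine Finset.sum_congr (by ext A; simp) fun A hA => ?_
      rw [if_pos ((meet_indB_eq_false_iff x A).2 hA), mul_one]
    rw [e2]
    set T := (trueSet x)ᶜ with hT
    have hTc : T.card = Fintype.card (ZMod m) - (trueSet x).card := card_compl _
    have hle : (trueSet x).card ≤ Fintype.card (ZMod m) := card_le_univ _
    have e3 : ∀ A ∈ T.powerset, p ^ A.card * (1 - p) ^ (Fintype.card (ZMod m) - A.card) =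
        (1 - p) ^ (trueSet x).card * (p ^ A.card * (1 - p) ^ (T.card - A.card)) := by
      intro A hA
      have hA' : A.card ≤ T.card := card_le_card (mem_powerset.1 hA)
      have : Fintype.card (ZMod m) - A.card = (trueSet x).card + (T.card - A.card) := by omega
      rw [this, pow_add]; ring
    rw [Finset.sum_congr rfl e3, ← Finset.mul_sum, Finset.sum_pow_mul_eq_add_pow]
    ring
  rw [hno] at htot
  linarith

/-- **Regrouping by the number of open layers**: for a summand `φ(#x)` depending on the number of open layers only,
`Σ_x π_p(x) [meet H x] φ(#x) = Σ_{u ≤ m} (C(m,u) - C(m-h,u)) p^u (1-p)^{m-u} φ(u)` with `h = #H`. -/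
theorem sum_wt_meet_mul_eq (p : ℝ) (H : ZMod m → Bool) (φ : ℕ → ℝ) :
    ∑ x : ZMod m → Bool, wt p x * ((if meet m H x = true then (1 : ℝ) else 0) * φ (trueSet x).card) =
      ∑ u ∈ range (m + 1), (((m.choose u : ℕ) : ℝ) - ((m - (trueSet H).card).choose u : ℕ)) *
        (p ^ u * (1 - p) ^ (m - u) * φ u) := by
  classical
  rw [sum_wt_eq_sum_finset]
  have hind : ∀ A : Finset (ZMod m), trueSet (indB A) = A := fun A => trueSetEquiv.right_inv A
  simp only [hind, card_zmod]
  -- indicator = 1 - [no meet]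
  have e1 : ∀ A : Finset (ZMod m), p ^ A.card * (1 - p) ^ (m - A.card) *
      ((if meet m H (indB A) = true then (1 : ℝ) else 0) * φ A.card) =
      p ^ A.card * (1 - p) ^ (m - A.card) * φ A.card -
        (if A ∈ (trueSet H)ᶜ.powerset then p ^ A.card * (1 - p) ^ (m - A.card) * φ A.card else 0) := by
    intro A
    by_cases h : meet m H (indB A) = true
    · have : A ∉ (trueSet H)ᶜ.powerset := fun h' => by
        rw [← meet_indB_eq_false_iff] at h'; rw [h'] at h; exact Bool.false_ne_true h
      rw [if_pos h, if_neg this]; ring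
    · have h' : A ∈ (trueSet H)ᶜ.powerset := (meet_indB_eq_false_iff H A).1 (Bool.eq_false_iff.2 h)
      rw [if_neg h, if_pos h']; ring
  rw [Finset.sum_congr rfl fun A _ => e1 A, Finset.sum_sub_distrib, ← Finset.sum_filter]
  have hfilt : (univ.filter fun A : Finset (ZMod m) => A ∈ (trueSet H)ᶜ.powerset) = (trueSet H)ᶜ.powerset := by
    ext A; simp
  rw [hfilt]
  -- both sums grouped by cardinality
  have hall : ∑ A : Finset (ZMod m), p ^ A.card * (1 - p) ^ (m - A.card) * φ A.card =
      ∑ u ∈ range (m + 1), (m.choose u : ℝ) * (p ^ u * (1 - p) ^ (m - u) * φ u) := by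
    have := sum_powerset_card_eq (univ : Finset (ZMod m)) (fun n => p ^ n * (1 - p) ^ (m - n) * φ n)
    rw [Finset.card_univ, card_zmod] at this
    rw [← this, Finset.powerset_univ]
  have hcomp : ∑ A ∈ (trueSet H)ᶜ.powerset, p ^ A.card * (1 - p) ^ (m - A.card) * φ A.card =
      ∑ u ∈ range (m + 1), ((m - (trueSet H).card).choose u : ℝ) * (p ^ u * (1 - p) ^ (m - u) * φ u) := by
    have := sum_powerset_card_eq (trueSet H)ᶜ (fun n => p ^ n * (1 - p) ^ (m - n) * φ n)
    have hc : (trueSet H)ᶜ.card = m - (trueSet H).card := by rw [card_compl, card_zmod]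
    rw [this, hc]
    -- extend the range from `m - h + 1` to `m + 1` by zero terms
    have hle : (trueSet H).card ≤ m := by
      have := card_le_univ (trueSet H); rw [card_zmod] at this; exact this
    have hsub : range (m - (trueSet H).card + 1) ⊆ range (m + 1) := range_subset_range.2 (by omega)
    rw [← Finset.sum_subset hsub]
    intro u hu hu'
    rw [mem_range] at hu hu'
    rw [Nat.choose_eq_zero_of_lt (by omega)]; simp
  rw [hall, hcomp, ← Finset.sum_sub_distrib]
  exact Finset.sum_congr rfl fun u _ => by ring

/-- **Per-type dominance from the tail table**: if for every `j = 1, …, k` the closed-form tail inequality for the hit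
size `h = #H` holds, then for every step test function `g` of a set `C` of `k` children,
`(Σ_x π_p(x)[meet H x]) · E_{π_s}[g] ≤ Σ_x π_p(x)[meet H x] · E_{π_{1-(1-p)^{#x}}}[g]`. -/
theorem typeIneq_of_table {V : Type*} [Fintype V] [DecidableEq V] (p s : ℝ) (H : ZMod m → Bool) (C : Finset V)
    (htab : ∀ j, 1 ≤ j → j ≤ C.card →
      (∑ u ∈ range (m + 1), (((m.choose u : ℕ) : ℝ) - ((m - (trueSet H).card).choose u : ℕ)) *
          (p ^ u * (1 - p) ^ (m - u) * 1)) * binTail C.card s j ≤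
        ∑ u ∈ range (m + 1), (((m.choose u : ℕ) : ℝ) - ((m - (trueSet H).card).choose u : ℕ)) *
          (p ^ u * (1 - p) ^ (m - u) * binTail C.card (1 - (1 - p) ^ u) j))
    {g : (V → Bool) → ℝ} (hg : StepTest C g) :
    (∑ x : ZMod m → Bool, wt p x * (if meet m H x = true then (1 : ℝ) else 0)) * (∑ ω : V → Bool, wt s ω * g ω) ≤
      ∑ x : ZMod m → Bool, wt p x * (if meet m H x = true then (1 : ℝ) else 0) *
        ∑ ω : V → Bool, wt (1 - (1 - p) ^ (trueSet x).card) ω * g ω := by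
  have key := mixture_dominates_of_tails (X := ZMod m → Bool) C
    (fun x => wt p x * (if meet m H x = true then (1 : ℝ) else 0)) (fun x => 1 - (1 - p) ^ (trueSet x).card) s
    (fun j hj1 hjk => ?_) hg
  · exact key
  -- the tail hypothesis is the table entry, after regrouping by the number of open layers
  have e0 : ∑ x : ZMod m → Bool, wt p x * (if meet m H x = true then (1 : ℝ) else 0) =
      ∑ x : ZMod m → Bool, wt p x * ((if meet m H x = true then (1 : ℝ) else 0) * (fun _ => (1 : ℝ)) (trueSet x).card) :=
    Finset.sum_congr rfl fun x _ => by simp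
  have e1 : ∑ x : ZMod m → Bool, wt p x * (if meet m H x = true then (1 : ℝ) else 0) * binTail C.card (1 - (1 - p) ^ (trueSet x).card) j =
      ∑ x : ZMod m → Bool, wt p x * ((if meet m H x = true then (1 : ℝ) else 0) *
        (fun n => binTail C.card (1 - (1 - p) ^ n) j) (trueSet x).card) :=
    Finset.sum_congr rfl fun x _ => by ring
  rw [e0, e1, sum_wt_meet_mul_eq p H (fun _ => (1 : ℝ)), sum_wt_meet_mul_eq p H (fun n => binTail C.card (1 - (1 - p) ^ n) j)]
  exact htab j hj1 hjk

end TFib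

end Summit.CriticalPhenomena.PercolationContinuityZ3.Theorems.Pcint
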